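import Summits.Ventures.Crystal3D.Theorems.StickyWulffConstantTextureLiminfTexShadowLevelReachPlatesMultiCut
import Summits.Ventures.Crystal3D.Theorems.StickyWulffConstantTextureLiminfTexShadowLevelReachCoSlot
import Summits.Ventures.Crystal3D.Theorems.StickyWulffConstantCoaxialWallLawBarlowOneFccExport
import HarnessLib

/-!
# ALL rising hexagon classes of a clamped BARLOW plate, each CUT at everything it crosses, POOLED: lane F's plate discharges + LEMMA X
# (lane T, crux `TextureLiminfV5`, stmt-Ventures-23912, registered stub `stub_terraceCensus`; (β)-lite × cut census — the plates-side input of the origins-based assembly, HOME/wall-p1-g22/BETA-CUT-g22.md §4(c)/§5)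

HONEST FRAMING. Venture `Summits/Ventures/Crystal3D` (cell `crystal3d-full`), route `route-Ventures-StickyWulffConstant`, helper `--supports` the law-v5
crux `TextureLiminfV5` (stmt-Ventures-23912), lane T.  Census-free, certificate-free; `KissingGap δ`, `KissingClassification δ` BY NAME as in lane F's
'…BarlowOneFccExport' (the template of this file); nothing about energies; F-C1 not moved.

THE POINT.  `coSlot_barlow_endPairs` (…LevelReachCoSlotBarlow) for ALL rising hexagon roots `r ∈ inPlaneRoots Fr 1` of the clamped Barlow bottom plate at
once, each class cut at everything it crosses (`C r μ :↔ ⟪r, μ⟫ = √(2/3)`), pooled into ONE end set by LEMMA X (`word_endPairs_multi_plates_cuts`,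
…LevelReachPlatesMultiCut p743934), with lane F's discharges verbatim and the root-frame top exclusion for a clamped Barlow top plate neither of whose dozens is
the root dozen.  **`hexagon_barlow_endPairs_cuts`**: `Σ_r #{r-sources} ≤ #T + Σ_r #CUT_r + #RT·(220·#rim_top + 220·#rim_bot)` — the LEFT side is EXACTLY the
source sum of lane F's flux bound `oneFcc_srcA_ge` (…OneFccFluxF: `≥` the hexagon flux of the plate, NO class removed), `T` in the `⟨Fr, inPlaneRoots Fr 1⟩`
plate-system form of `card_endPairs_le_of_localRow`.  With no threading class removed and no `B1`/`B2` in-plane reasoning: every class is cut, every walk is a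
straight root-frame line.  On a filling whose hexagon lines meet no coherent cut plane all `#CUT_r = 0` (memo §3(i)).
WHAT THIS IS NOT: the certificate, the currency glue to `BilayerWallAt`, the top plate's own (downward) census; F-C1 not moved.
-/

noncomputable section

namespace Summit.Ventures.Crystal3D.Theorems

open Summit.Ventures.Crystal3D Finset
open Literature.MathematicalPhysics.StatisticalMechanics (barlowPos barlowStacking IsHaggSeq barlowPos_mem basalMirror)
open Summit.Ventures.Crystal3D.Cruxes.TextureLiminf.TexShadow (E3 stacking)
open scoped InnerProductSpace

open scoped Classical in
/-- **All cut hexagon classes of a clamped Barlow plate, pooled: end pairs, typed export.**  See the module docstring. -/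
theorem hexagon_barlow_endPairs_cuts (ver : WordVersion) {δ : ℝ} (hg : KissingGap δ) (hc : KissingClassification δ)
    {σ₁ σ₂ : ℤ → ℤ} (hσ₁ : IsHaggSeq σ₁) (hσ₂ : IsHaggSeq σ₂) (L₁ L₂ : E3 ≃ₗᵢ[ℝ] E3) (s₁ s₂ : E3)
    (Fr : E3 ≃ₗᵢ[ℝ] E3) {t : ℤ} (hFr : (t = 1 ∧ Fr = L₁) ∨ (t = -1 ∧ Fr = basalMirror.trans L₁))
    (hne₁ : (Fr : E3 → E3) '' ↑fccSlots ≠ (L₂ : E3 → E3) '' ↑fccSlots)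
    (hne₂ : (Fr : E3 → E3) '' ↑fccSlots ≠ ((basalMirror.trans L₂ : E3 ≃ₗᵢ[ℝ] E3) : E3 → E3) '' ↑fccSlots)
    (X P₁ P₂ : Finset E3) (R₀ h ρ : ℝ) (hR₀ : 5 ≤ R₀) (hρ : R₀ + 2 ≤ ρ)
    (hX : ∀ p ∈ X, ∀ q ∈ X, p ≠ q → 1 ≤ dist p q) (hP₁X : P₁ ⊆ X) (hP₂X : P₂ ⊆ X)
    (hP₁ : ∀ p, p ∈ P₁ ↔ (p ∈ stacking L₁ s₁ σ₁ ∧ -(2 * R₀) ≤ p 2 ∧ p 2 ≤ -R₀ ∧ p 0 ^ 2 + p 1 ^ 2 ≤ ρ ^ 2))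
    (hP₂ : ∀ p, p ∈ P₂ ↔ (p ∈ stacking L₂ s₂ σ₂ ∧ h + R₀ ≤ p 2 ∧ p 2 ≤ h + 2 * R₀ ∧ p 0 ^ 2 + p 1 ^ 2 ≤ ρ ^ 2)) :
    ∃ T : Finset (E3 × E3),
      (∑ r ∈ inPlaneRoots Fr 1,
        ((P₁.filter fun p => -(R₀ + 1) - 1 - 1 ≤ p 2 ∧ p 2 ≤ -(R₀ + 1) - 1 ∧ p 0 ^ 2 + p 1 ^ 2 ≤ (ρ - 1 - 1) ^ 2).filter
          fun p => (∃ k i j : ℤ, p = L₁ (barlowPos 1 (Real.sqrt (2 / 3)) σ₁ k i j) + s₁ ∧ ¬ (σ₁ (k - 1) = -t ∧ σ₁ k = -t)) ∧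
            -(R₀ + 1) - 1 < (p + Fr r) 2 ∧ (p + Fr r) 2 < h + (R₀ + 1) + 1).card) ≤
        T.card +
        ∑ r ∈ inPlaneRoots Fr 1, (X.filter fun b => -(R₀ + 1) - 1 ≤ b 2 ∧ b 2 < h + (R₀ + 1) + 1 ∧
            (∃ μ, ⟪r, μ⟫_ℝ = Real.sqrt (2 / 3) ∧ IsTwinReading X Fr (Fr μ) b) ∧ b - Fr r ∈ X).card +
        (inPlaneRoots Fr 1).card *
          (220 * (X.filter fun s => h + (R₀ + 1) + 1 ≤ s 2 ∧ s 2 ≤ h + (R₀ + 1) + 1 + 1 ∧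
              (ρ - 1 - 2) ^ 2 < s 0 ^ 2 + s 1 ^ 2).card +
            220 * (X.filter fun s => -(R₀ + 1) - 1 - 1 ≤ s 2 ∧ s 2 < -(R₀ + 1) - 1 ∧
              (ρ - 1 - 1) ^ 2 < s 0 ^ 2 + s 1 ^ 2).card) ∧
      (∀ bq ∈ T, bq.1 ∈ X ∧ bq.2 ∈ X ∧ dist bq.1 bq.2 = 1 ∧ -(R₀ + 1) - 1 ≤ bq.1 2 ∧ bq.1 2 < h + (R₀ + 1) + 1) ∧
      (∀ bq ∈ T, (X.filter fun q => dist bq.1 q = 1).card ≤ 11 ∨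
        ∃ z₁ ∈ X, ∃ z₂ ∈ X, z₁ ≠ z₂ ∧ dist bq.1 z₁ = 1 ∧ dist bq.1 z₂ = 1 ∧
          (X.filter fun q => dist z₁ q = 1).card ≤ 11 ∧ (X.filter fun q => dist z₂ q = 1).card ≤ 11) ∧
      (∀ bq ∈ T, ∃ r' ∈ inPlaneRoots Fr 1, ∃ κ : List E3, WFChain r' κ ∧
        bq.2 - (⟨Fr, inPlaneRoots Fr 1⟩ : PlateSystem).Fw κ (((-1 : ℝ) ^ κ.length) • r') ∈ X ∧
        IsEndMove X ver ((⟨Fr, inPlaneRoots Fr 1⟩ : PlateSystem).Fw κ)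
          ((⟨Fr, inPlaneRoots Fr 1⟩ : PlateSystem).Fw κ (((-1 : ℝ) ^ κ.length) • r')) bq.2 bq.1) := by
  set RT := inPlaneRoots Fr 1 with hRTdef
  have hRT : ∀ r ∈ RT, r ∈ fccSlots := fun r hr => (mem_filter.1 hr).1
  have hRT2 : ∀ r ∈ RT, r 2 = 0 := fun r hr => (mem_filter.1 hr).2.1
  have hRTup : ∀ r ∈ RT, 0 < (Fr r) 2 := fun r hr => by
    have := (mem_filter.1 hr).2.2; rwa [one_mul] at this
  -- the word data over the base frame `Fr`
  set Fw : List E3 → (E3 ≃ₗᵢ[ℝ] E3) := fun κ => κ.foldr (fun μ G => ((ℝ ∙ μ)ᗮ.reflection).trans G) Fr with hFw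
  set uw : E3 → List E3 → E3 := fun r κ => κ.foldr (fun _ v => -v) r with huw
  set WFw : E3 → List E3 → Prop := fun r κ =>
    List.rec (motive := fun _ => Prop) True (fun μ κ' ih => ih ∧ ‖μ‖ = 1 ∧
      (∀ w ∈ fccSlots, ⟪w, μ⟫_ℝ = 0 ∨ ⟪w, μ⟫_ℝ = Real.sqrt (2 / 3) ∨ ⟪w, μ⟫_ℝ = -Real.sqrt (2 / 3)) ∧
      ⟪uw r κ', μ⟫_ℝ = Real.sqrt (2 / 3) ∧ ∀ μ' κ'', κ' = μ' :: κ'' → μ' ≠ -μ) κ with hWFw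
  set nextw : List E3 → E3 → List E3 :=
    fun κ m => @ite _ (∃ μ κ', κ = μ :: κ' ∧ (Fw κ).symm m = -μ) (Classical.propDecidable _) κ.tail
      ((Fw κ).symm m :: κ) with hnextw
  have hF0 : Fw [] = Fr := rfl
  have hFc : ∀ μ κ, Fw (μ :: κ) = ((ℝ ∙ μ)ᗮ.reflection).trans (Fw κ) := fun _ _ => rfl
  have hu0 : ∀ r, uw r [] = r := fun _ => rfl
  have huc : ∀ r μ κ, uw r (μ :: κ) = -uw r κ := fun _ _ _ => rfl
  have hWF0 : ∀ r, WFw r [] := fun _ => trivial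
  have hWFc : ∀ r μ κ, WFw r (μ :: κ) ↔ (WFw r κ ∧ ‖μ‖ = 1 ∧
      (∀ w ∈ fccSlots, ⟪w, μ⟫_ℝ = 0 ∨ ⟪w, μ⟫_ℝ = Real.sqrt (2 / 3) ∨ ⟪w, μ⟫_ℝ = -Real.sqrt (2 / 3)) ∧
      ⟪uw r κ, μ⟫_ℝ = Real.sqrt (2 / 3) ∧ ∀ μ' κ', κ = μ' :: κ' → μ' ≠ -μ) := fun _ _ _ => Iff.rfl
  have hnext_pop : ∀ μ κ' (m : E3), (Fw (μ :: κ')).symm m = -μ → nextw (μ :: κ') m = κ' := by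
    intro μ κ' m hν
    simp only [hnextw]
    rw [if_pos ⟨μ, κ', rfl, hν⟩, List.tail_cons]
  have hnext_push : ∀ κ (m : E3), (∀ μ κ', κ = μ :: κ' → (Fw κ).symm m ≠ -μ) → nextw κ m = (Fw κ).symm m :: κ := by
    intro κ m hnp
    simp only [hnextw]
    rw [if_neg]
    rintro ⟨μ, κ', h, hν⟩
    exact hnp μ κ' h hν
  clear_value nextw WFw uw Fw
  have hu : ∀ r ∈ RT, ∀ κ, uw r κ ∈ fccSlots := fun r hr => word_u_mem (hRT r hr) (hu0 r) (huc r)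
  -- the cell: clamps, core band, top band
  set W₁ : Set E3 := {x : E3 | -(2 * R₀) ≤ x 2 ∧ x 2 ≤ -R₀ ∧ x 0 ^ 2 + x 1 ^ 2 ≤ ρ ^ 2} with hW₁
  set W₂ : Set E3 := {x : E3 | h + R₀ ≤ x 2 ∧ x 2 ≤ h + 2 * R₀ ∧ x 0 ^ 2 + x 1 ^ 2 ≤ ρ ^ 2} with hW₂
  have hplate₁ : ∀ p ∈ stacking L₁ s₁ σ₁, p ∈ W₁ → p ∈ X := plate_mem_of_clamp₁ L₁ s₁ hP₁X hP₁
  have hplate₂ : ∀ p ∈ stacking L₂ s₂ σ₂, p ∈ W₂ → p ∈ X := plate_mem_of_clamp₂ L₂ s₂ hP₂X hP₂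
  set CORE := P₁.filter (fun p => -(R₀ + 1) - 1 - 1 ≤ p 2 ∧ p 2 ≤ -(R₀ + 1) - 1 ∧
    p 0 ^ 2 + p 1 ^ 2 ≤ (ρ - 1 - 1) ^ 2) with hCORE
  set TOP := P₂.filter (fun p => h + (R₀ + 1) + 1 ≤ p 2 ∧ p 2 ≤ h + (R₀ + 1) + 1 + 1 ∧
    p 0 ^ 2 + p 1 ^ 2 ≤ (ρ - 1 - 2) ^ 2) with hTOP
  have hcore : ∀ p ∈ CORE, ∃ k i j : ℤ, p = L₁ (barlowPos 1 (Real.sqrt (2 / 3)) σ₁ k i j) + s₁ ∧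
      ∀ x, dist p x ≤ 2 → x ∈ W₁ := coreBand₁_deep L₁ s₁ hP₁ hR₀ (by linarith)
  have htop : ∀ p ∈ TOP, ∃ k i j : ℤ, p = L₂ (barlowPos 1 (Real.sqrt (2 / 3)) σ₂ k i j) + s₂ ∧
      ∀ x, dist p x ≤ 2 → x ∈ W₂ := topBand₂_deep L₂ s₂ hP₂ hR₀ (by linarith)
  set srcOK : E3 → E3 → Prop := fun _ p =>
    ∃ k i j : ℤ, p = L₁ (barlowPos 1 (Real.sqrt (2 / 3)) σ₁ k i j) + s₁ ∧ ¬ (σ₁ (k - 1) = -t ∧ σ₁ k = -t) with hsrcOK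
  -- the internal invariant: ROOT class and predecessor present
  set P : E3 → E3 × List E3 → Prop := fun r v => v.2 = [] ∧ (v.1 ∈ X ∧ v.1 - Fw v.2 (uw r v.2) ∈ X) with hPdef
  -- (1) sources (lane F) with the invariant one step later
  have hPsrc : ∀ r ∈ RT, ∀ p ∈ CORE, srcOK r p → p ∈ X ∧
      (∃ a ∈ fccSlots, ∃ a' ∈ fccSlots, ∃ a'' ∈ fccSlots,
        ⟪a, a'⟫_ℝ = 1 / 2 ∧ ⟪a, a''⟫_ℝ = 1 / 2 ∧ ⟪a', a''⟫_ℝ = 1 / 2 ∧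
        p + Fw [] a ∈ X ∧ p + Fw [] a' ∈ X ∧ p + Fw [] a'' ∈ X) ∧
      p - Fw [] r ∈ X ∧
      (IsFull X (Fw []) p ∨ (∃ m, IsTwinReading X (Fw []) m p ∧ ⟪Fw [] r, m⟫_ℝ = 0) ∨
        (ver = WordVersion.v2 ∧ IsNarrow X (Fw []) (Fw [] r) p)) ∧
      P r (p + Fw [] r, []) := by
    intro r hr
    have key : ∀ p ∈ CORE, srcOK r p → p ∈ X ∧
        (∃ a ∈ fccSlots, ∃ a' ∈ fccSlots, ∃ a'' ∈ fccSlots,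
          ⟪a, a'⟫_ℝ = 1 / 2 ∧ ⟪a, a''⟫_ℝ = 1 / 2 ∧ ⟪a', a''⟫_ℝ = 1 / 2 ∧
          p + Fw [] a ∈ X ∧ p + Fw [] a' ∈ X ∧ p + Fw [] a'' ∈ X) ∧
        p - Fw [] r ∈ X ∧
        (IsFull X (Fw []) p ∨ (∃ m, IsTwinReading X (Fw []) m p ∧ ⟪Fw [] r, m⟫_ℝ = 0) ∨
          (ver = WordVersion.v2 ∧ IsNarrow X (Fw []) (Fw [] r) p)) ∧
        (fun (_ : E3 × List E3) => True) (p + Fw [] r, []) := by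
      rcases hFr with ⟨ht, hFrL⟩ | ⟨ht, hFrL⟩
      · refine hPsrc_of_plateCore_frame hσ₁ L₁ s₁ hX hplate₁ ver (hRT r hr) (hRT2 r hr) CORE (srcOK r)
          (P := fun _ => True) (by rw [hF0, hFrL]) ?_ (fun _ _ _ => trivial)
        intro p hp hok
        obtain ⟨k, i, j, hpk, hsg⟩ := hok
        obtain ⟨-, -, -, -, hball⟩ := hcore p hp
        refine ⟨k, i, j, hpk, hball, ?_⟩
        rw [ht] at hsg; simpa using hsg
      · refine hPsrc_of_plateCore_mirror hσ₁ L₁ s₁ hX hplate₁ ver (hRT r hr) (hRT2 r hr) CORE (srcOK r)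
          (P := fun _ => True) (by rw [hF0, hFrL]) ?_ (fun _ _ _ => trivial)
        intro p hp hok
        obtain ⟨k, i, j, hpk, hsg⟩ := hok
        obtain ⟨-, -, -, -, hball⟩ := hcore p hp
        refine ⟨k, i, j, hpk, hball, ?_⟩
        rw [ht] at hsg; simpa using hsg
    intro p hp hok
    obtain ⟨h1, h2, h3, h4, -⟩ := key p hp hok
    refine ⟨h1, h2, h3, h4, rfl, ?_⟩
    have := predInv_straight (X := X) (F := Fw) (u := uw r) (hu r hr) (κ := []) (by rw [hu0]; exact h4) ⟨h1, by rw [hu0]; exact h3⟩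
    rw [hu0] at this
    exact ⟨this.1, by rw [hu0]; exact this.2⟩
  -- (2) core rigidity (lane F)
  have hstd : ∀ r ∈ RT, ∀ κ, WFw r κ → ∀ p ∈ CORE, (∃ a ∈ fccSlots, ∃ a' ∈ fccSlots, ∃ a'' ∈ fccSlots,
        ⟪a, a'⟫_ℝ = 1 / 2 ∧ ⟪a, a''⟫_ℝ = 1 / 2 ∧ ⟪a', a''⟫_ℝ = 1 / 2 ∧
        p + Fw κ a ∈ X ∧ p + Fw κ a' ∈ X ∧ p + Fw κ a'' ∈ X) → Fw κ (uw r κ) = Fw [] r := by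
    intro r hr κ hκ p hp hface
    have key : Fw κ (uw r κ) = Fw [] (uw r []) := by
      rcases hFr with ⟨-, hFrL⟩ | ⟨-, hFrL⟩
      · exact hstd_of_plateCore hσ₁ L₁ s₁ hX hplate₁ ⟨LinearIsometryEquiv.refl ℝ E3, RT⟩
          PlateSystem.standardPair_refl hFc (by rw [hF0, hFrL]; rfl) (hRT2 r hr) (hu0 r) (huc r) (hWFc r) CORE hcore κ hκ p hp hface
      · exact hstd_of_plateCore hσ₁ L₁ s₁ hX hplate₁ ⟨basalMirror, RT⟩
          PlateSystem.standardPair_basalMirror hFc (by rw [hF0, hFrL]) (hRT2 r hr) (hu0 r) (huc r) (hWFc r) CORE hcore κ hκ p hp hface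
    rw [key, hu0]
  -- (3) ROOT-FRAME top exclusion (the top plate's two dozens are not the root dozen), lifted to the root-class invariant
  have hne₁' : ((Fw []) : E3 → E3) '' ↑fccSlots ≠ (L₂ : E3 → E3) '' ↑fccSlots := by rw [hF0]; exact hne₁
  have hne₂' : ((Fw []) : E3 → E3) '' ↑fccSlots ≠ ((basalMirror.trans L₂ : E3 ≃ₗᵢ[ℝ] E3) : E3 → E3) '' ↑fccSlots := by
    rw [hF0]; exact hne₂
  have hPexcl0 : ∀ r ∈ RT, ∀ (b : E3) (κ : List E3), WFw r κ → P r (b, κ) → b ∈ TOP →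
      (∃ a ∈ fccSlots, ∃ a' ∈ fccSlots, ∃ a'' ∈ fccSlots,
        ⟪a, a'⟫_ℝ = 1 / 2 ∧ ⟪a, a''⟫_ℝ = 1 / 2 ∧ ⟪a', a''⟫_ℝ = 1 / 2 ∧
        b + Fw κ a ∈ X ∧ b + Fw κ a' ∈ X ∧ b + Fw κ a'' ∈ X) → False :=
    fun r _ => hPexcl0_root_of_receivingBarlowPlate hσ₂ L₂ s₂ hX hplate₂ (F := Fw) (WF := WFw r) hne₁' hne₂' TOP htop (P r) (fun _ _ h => h.1)
  -- the invariant along straight moves; the cross clause is vacuous (every crossing letter is cut)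
  have hPstraight : ∀ r ∈ RT, ∀ (b : E3) (κ : List E3), WFw r κ →
      (IsFull X (Fw κ) b ∨ (∃ m, IsTwinReading X (Fw κ) m b ∧ ⟪Fw κ (uw r κ), m⟫_ℝ = 0) ∨
        (ver = WordVersion.v2 ∧ IsNarrow X (Fw κ) (Fw κ (uw r κ)) b)) → P r (b, κ) → P r (b + Fw κ (uw r κ), κ) := by
    rintro r hr b κ - hmv ⟨hnil, hb⟩
    exact ⟨hnil, predInv_straight (hu r hr) hmv hb⟩
  have hPcross : ∀ r ∈ RT, ∀ (b : E3) (κ : List E3) (m : E3), WFw r κ → WFw r (nextw κ m) → IsTwinReading X (Fw κ) m b →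
      ⟪Fw κ (uw r κ), m⟫_ℝ = Real.sqrt (2 / 3) → (κ ≠ [] ∨ ¬ ⟪r, (Fw []).symm m⟫_ℝ = Real.sqrt (2 / 3)) → P r (b, κ) →
      P r (b + Fw (nextw κ m) (uw r (nextw κ m)), nextw κ m) := by
    rintro r hr b κ m - - - hdm hoff ⟨hnil, -⟩
    exfalso
    have hnil' : κ = [] := hnil
    subst hnil'
    rcases hoff with h0 | h0
    · exact h0 rfl
    · apply h0
      rw [← LinearIsometryEquiv.inner_map_map (Fw []), LinearIsometryEquiv.apply_symm_apply, ← hu0 r]; exact hdm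
  -- (4) sealing (lane F)
  have hsealB := sealing_below_barlow L₁ s₁ hX hP₁X hP₁ (R₀ := R₀) (ρ := ρ) (by linarith) (by linarith)
  have hP₂seal := sealing_above_barlow L₂ s₂ hX hP₂X hP₂ (R₀ := R₀) (h := h) (ρ := ρ) (by linarith) (by linarith)
  -- (5) the pooled cut census
  have hup : ∀ r ∈ RT, 0 < (Fw [] r) 2 := fun r hr => by rw [hF0]; exact hRTup r hr
  have hP'top : ∀ p ∈ CORE, p 2 ≤ -(R₀ + 1) - 1 := fun p hp => (mem_filter.1 hp).2.2.1
  obtain ⟨T, hkey, hTpair, hTpay, hTwit⟩ := word_endPairs_multi_plates_cuts ver (F := Fw) (u := uw) (WF := WFw)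
    (next := nextw) (P := P) hg hc hX hFc RT hRT (fun r _ => hu0 r) (fun r _ => huc r)
    (fun r _ => hWF0 r) (fun r _ => hWFc r) hnext_pop hnext_push (fun r => fun μ => ⟪r, μ⟫_ℝ = Real.sqrt (2 / 3))
    (fun r _ μ h => by rw [hu0]; exact h) hPstraight hPcross hPexcl0 hup (by linarith : (3 : ℝ) ≤ R₀ + 1) (by linarith : R₀ + 1 ≤ ρ - 1)
    srcOK hP'top hPsrc hstd hsealB hP₂seal
  rw [hF0] at hkey
  simp only [hsrcOK] at hkey
  -- (6) the witnesses in the plate-system form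
  set S : PlateSystem := ⟨Fr, RT⟩ with hS
  have hFwS : ∀ κ, Fw κ = S.Fw κ := by
    intro κ
    induction κ with
    | nil => rw [hF0]; rfl
    | cons μ κ ih => rw [hFc, ih]; rfl
  refine ⟨T, ?_, hTpair, hTpay, ?_⟩
  · refine hkey.trans (Nat.add_le_add_right (Nat.add_le_add_left (Finset.sum_le_sum fun r hr => card_le_card fun b hb => ?_) _) _)
    simp only [Finset.mem_filter] at hb ⊢
    obtain ⟨hbX, h1, h2, hread, -, hpred⟩ := hb
    exact ⟨hbX, h1, h2, hread, hpred⟩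
  intro bq hbq
  obtain ⟨r, hr, -, κ, hκ, hpred, hmove⟩ := hTwit bq hbq
  have hWF : WFChain r κ := wfChain_of_wf (hu0 r) (huc r) (hWFc r) κ hκ
  have huκ : uw r κ = ((-1 : ℝ) ^ κ.length) • r := word_u_eq_pow_root (hu0 r) (huc r) κ
  rw [huκ, hFwS] at hpred hmove
  exact ⟨r, hr, κ, hWF, hpred, hmove⟩

end Summit.Ventures.Crystal3D.Theorems

end
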